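import Summits.NavierStokesRegularity.NavierStokesRegularity.Theorems.SoloRefuteSiche2026HeatModes
import Summits.NavierStokesRegularity.NavierStokesRegularity.Theorems.SoloRefuteSiche2026Shear
import Summits.NavierStokesRegularity.NavierStokesRegularity.Theorems.SoloRefuteSiche2026Lattice
import HarnessLib

/-!
# C135 `Siche2026` — refutation of Step 2 (Prop. 5.9 p. 10, forcing-induced dephasing) and
# Step 3 (Lemma 6.7 p. 14, contraction along the flow) by the single-mode shear heat flow

D-0090 NS-CLAIMS SWEEP, row C135 (`Literature.Claims.NS.Siche2026`, B. Siche, «Phase Decoherence and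
Regularity of the Three-Dimensional Navier–Stokes Equations», Zenodo 10.5281/zenodo.19899171, v1.5).

**Countermodel.** `U(t, x) = e^{-4π²ν n² t} sin(2π n x₀) ŷ`, `n = 5^j`: an exact classical solution of the
unforced Navier–Stokes system on `ℝ × 𝕋³` (zero pressure; `(U·∇)U = 0`), restricted to `[0, T)`. Under the
typed Definition 4.1 (gauge (39)) its only active shell is `K = n² = 25^j`, where the four helical coordinates
`c^σ_{±n e₀}(t)` share the common factor `e^{-4π²νn²t}` and have ALIGNED phases at `x = 0`:
`|m_K(t)| = 1` and `χ_K(t) = N_K = 2·#S_{25^j} ≥ 2(j + 1)` for EVERY `t` (`succ_le_card_shell`).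

* `not_Step2_dephasing`: given `C_dec > 0`, `C_χ`, take `ν = 1`, `j ≥ 1` with `#S_{25^j} > C_χ`
  (`K = 25^j ≥ 5`, `S_K ∋ n e₀`), `t₀ := C_dec/(√(2E₀)√K) ≥ 0`, `T := t₀ + 1`: the printed conclusion
  `χ_K(t₀) ≤ C_χ` fails since `χ_K(t₀) = N_K > C_χ`.
* `not_Step3_contraction`: given `c < 1`, `C₀`, `ν = 1` and the relaxation time `τ = τ_K(U(0)) > 0`, take `j`
  with `#S_{25^j} > (C₀/(1-c))²`, `t = 0`, `T := τ + 1`: then `R* = C₀/((1-c)√N_K) < 1 = |m_K(0)|` but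
  `|m_K(τ)| = 1 = |m_K(0)|` does not decrease.

Both printed statements are thus false as typed (frozen phases of exact shear heat flows: no forcing-induced
or bath-induced dephasing occurs along these Navier–Stokes solutions).

WHAT THIS IS NOT: not a claim about NS regularity or blow-up; not a claim about any author beyond the
typed locator.
-/

set_option linter.dupNamespace false

noncomputable section

open Set
open Literature.Analysis.FunctionSpaces Literature.Analysis.FunctionSpaces.Torus
open Literature.Claims.NS.Siche2026

namespace Summit.NavierStokesRegularity.NavierStokesRegularity.Theorems.Siche2026

/-! ## The single-mode shear heat flow -/

/-- `U(t) = Re (e^{-4π²ν n² t} α e^{2πinx₀}) ŷ`, the heat flow of the streamwise mode `n e₀`. -/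
def shearFlow (ν : ℝ) (n : ℤ) (α : ℂ) : ℝ → T3 → E3 :=
  heatFlow ν {kx n} fun _ => yC α

/-- at each time the shear heat flow is the single mode with the decayed profile `e^{-4π²νn²t} α`. [folklore] -/
theorem shearFlow_eq (ν : ℝ) (n : ℤ) (α : ℂ) (t : ℝ) :
    shearFlow ν n α t = shearMode n (((Real.exp (-(rate ν (kx n) * t)) : ℝ) : ℂ) * α) := by
  unfold shearFlow heatFlow shearMode heatCoeff
  refine realTrigPoly_congr fun k hk => ?_
  rw [Finset.mem_singleton] at hk
  subst hk
  exact (yC_smul _ _).symm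

/-- the shear heat flow is a classical solution of the unforced Navier–Stokes system (zero pressure)
on every time window `[0, T)`. -/
theorem isClassicalNSSolutionOn_shearFlow (ν : ℝ) (n : ℤ) (α : ℂ) (T : ℝ) :
    Torus.IsClassicalNSSolutionOn (Ico 0 T) ν 0 (shearFlow ν n α) fun _ _ => 0 := by
  have h : ∀ k ∈ ({kx n} : Finset Z3), ∀ l ∈ ({kx n} : Finset Z3), ∑ j, (l j : ℂ) * (fun _ => yC α) k j = 0 :=
    crossTransversal_of_streamwise (fun k hk => by
      rw [Finset.mem_singleton] at hk; subst hk; exact ⟨rfl, rfl⟩) (fun _ _ => rfl)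
  exact (isClassicalNSSolutionOn_heatFlow ν h).mono (subset_univ _) (uniqueDiffOn_Ico 0 T)

/-- **frozen phases**: along the SINE shear flow the on-shell magnetisation has modulus `1` at all times. -/
theorem norm_magnetization_shearFlow (ν : ℝ) {n : ℤ} (hn : 0 < n) {K : ℕ} (hK : kx n ∈ shell K) (t : ℝ) :
    ‖magnetization (shearFlow ν n (-Complex.I) t) K 0‖ = 1 := by
  have hr : 0 < Real.exp (-(rate ν (kx n) * t)) := Real.exp_pos _
  have hα : (((Real.exp (-(rate ν (kx n) * t)) : ℝ) : ℂ) * -Complex.I) ≠ 0 :=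
    mul_ne_zero (by exact_mod_cast hr.ne') (neg_ne_zero.2 Complex.I_ne_zero)
  rw [shearFlow_eq, norm_magnetization_shearMode_zero_of_mem hn hα hK, abs_im_div_norm_of_sine hr]

/-- hence its coherence is the full mode number `N_K` at all times. -/
theorem coherence_shearFlow (ν : ℝ) {n : ℤ} (hn : 0 < n) {K : ℕ} (hK : kx n ∈ shell K) (t : ℝ) :
    coherence (shearFlow ν n (-Complex.I) t) K 0 = shellModes K := by
  unfold coherence
  rw [norm_magnetization_shearFlow ν hn hK t, one_pow, mul_one]

/-- the streamwise mode `5^j e₀` lies on the shell `25^j`. -/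
theorem kx_five_pow_mem_shell (j : ℕ) : kx ((5 : ℤ) ^ j) ∈ shell (25 ^ j) := by
  rw [kx_mem_shell_iff]
  push_cast
  rw [← pow_mul, show (25 : ℤ) = 5 ^ 2 by norm_num, ← pow_mul, mul_comm]

/-! ## Step 2 (Proposition 5.9 p. 10) is false -/

/-- **Refutation of Step 2** (`Literature.Claims.NS.Siche2026.Step2_dephasing`, Prop. 5.9 (31) p. 10,
«Forcing-Induced Dephasing … χ_K(t) ≤ C_χ = O(1)» after the dephasing time): the single-mode shear heat flow
with `n = 5^j`, `ν = 1`, keeps `χ_{25^j}(t) = N_{25^j} ≥ 2(j + 1)` for all `t`, exceeding any `C_χ` at the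
dephasing time `t₀ = C_dec/(√(2E₀)√K)` on the window `[0, t₀ + 1)`.
[cite: Siche2026, Proposition 5.9 (31) p. 10] -/
theorem not_Step2_dephasing : ¬ Step2_dephasing := by
  rintro ⟨Cdec, Cχ, hdec, h⟩
  obtain ⟨j, hj, hjC⟩ := exists_shell_card_gt Cχ
  set n : ℤ := 5 ^ j with hn_def
  have hn : 0 < n := by positivity
  set K : ℕ := 25 ^ j with hK_def
  have hK : kx n ∈ shell K := kx_five_pow_mem_shell j
  have hK5 : 5 ≤ K := by
    calc 5 ≤ 25 ^ 1 := by norm_num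
      _ ≤ 25 ^ j := Nat.pow_le_pow_right (by norm_num) hj
  have hne : shell K ≠ ∅ := Finset.ne_empty_of_mem hK
  set U := shearFlow 1 n (-Complex.I) with hU
  set t₀ : ℝ := Cdec / (Real.sqrt (2 * Torus.kineticEnergy (U 0)) * Real.sqrt K) with ht₀
  have ht₀0 : 0 ≤ t₀ := div_nonneg hdec.le (mul_nonneg (Real.sqrt_nonneg _) (Real.sqrt_nonneg _))
  have hχ := h 1 one_pos (t₀ + 1) U (fun _ _ => 0) (isClassicalNSSolutionOn_shearFlow 1 n _ _) K hK5 hne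
    t₀ ⟨ht₀0, by linarith⟩ le_rfl
  rw [hU, coherence_shearFlow 1 hn hK t₀] at hχ
  have hN : ((shell K).card : ℝ) ≤ shellModes K := by
    unfold shellModes; push_cast; linarith [Nat.cast_nonneg (α := ℝ) (shell K).card]
  linarith

/-! ## Step 3 (Lemma 6.7 p. 14) is false -/

/-- **Refutation of Step 3** (`Literature.Claims.NS.Siche2026.Step3_contraction`, Lemma 6.7 p. 14, «for every
smooth bath trajectory … f_K(R; B(·)) < R for all K ≥ 3 and all R > R*»): along the single-mode shear heat
flow (`n = 5^j`, `ν = 1`) the magnetisation modulus is frozen at `|m_K| = 1 > R* = C₀/((1-c)√N_K)` once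
`N_{25^j} > (C₀/(1-c))²`, so it does not decrease over the relaxation time `τ_K`.
[cite: Siche2026, Lemma 6.7 p. 14; Theorem 6.4 (35) p. 12] -/
theorem not_Step3_contraction : ¬ Step3_contraction := by
  rintro ⟨c, C₀, hc0, hc1, hC0, h⟩
  obtain ⟨τ, hτ, h⟩ := h 1 one_pos
  obtain ⟨j, hj, hjC⟩ := exists_shell_card_gt ((C₀ / (1 - c)) ^ 2)
  set n : ℤ := 5 ^ j with hn_def
  have hn : 0 < n := by positivity
  set K : ℕ := 25 ^ j with hK_def
  have hK : kx n ∈ shell K := kx_five_pow_mem_shell j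
  have hK3 : 3 ≤ K := by
    calc 3 ≤ 25 ^ 1 := by norm_num
      _ ≤ 25 ^ j := Nat.pow_le_pow_right (by norm_num) hj
  set U := shearFlow 1 n (-Complex.I) with hU
  have hτ0 : 0 < τ K (U 0) := hτ K (U 0)
  have h1c : 0 < 1 - c := by linarith
  -- `R* < 1`
  have hN : ((shell K).card : ℝ) ≤ shellModes K := by
    unfold shellModes; push_cast; linarith [Nat.cast_nonneg (α := ℝ) (shell K).card]
  have hsqrt : C₀ / (1 - c) < Real.sqrt (shellModes K) := by
    rw [Real.lt_sqrt (div_nonneg hC0 h1c.le)]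
    linarith
  have hR : C₀ / ((1 - c) * Real.sqrt (shellModes K)) < 1 := by
    have hs0 : 0 < Real.sqrt (shellModes K) := lt_of_le_of_lt (div_nonneg hC0 h1c.le) hsqrt
    rw [div_lt_one (mul_pos h1c hs0)]
    calc C₀ = C₀ / (1 - c) * (1 - c) := by field_simp
      _ < Real.sqrt (shellModes K) * (1 - c) := mul_lt_mul_of_pos_right hsqrt h1c
      _ = (1 - c) * Real.sqrt (shellModes K) := mul_comm _ _
  have hlt := h (τ K (U 0) + 1) U (fun _ _ => 0) (isClassicalNSSolutionOn_shearFlow 1 n _ _) K hK3 0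
    ⟨le_rfl, by linarith⟩ ⟨by linarith, by linarith⟩
    (by rw [hU, norm_magnetization_shearFlow 1 hn hK 0]; exact hR)
  rw [hU, norm_magnetization_shearFlow 1 hn hK, norm_magnetization_shearFlow 1 hn hK] at hlt
  exact lt_irrefl _ hlt

end Summit.NavierStokesRegularity.NavierStokesRegularity.Theorems.Siche2026
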